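import Mathlib.AlgebraicGeometry.Morphisms.Proper
import Mathlib.AlgebraicGeometry.Morphisms.Finite
import Mathlib.AlgebraicGeometry.Morphisms.QuasiFinite
import Mathlib.AlgebraicGeometry.IdealSheaf.Subscheme
import Mathlib.Topology.KrullDimension
import HarnessLib

/-!
# A complete irreducible subset contained in an affine open is a point

Topic: `Literature/AlgebraicGeometry/Morphisms`. Pure proofs (no definition, no named fact) of the
classical fact behind "a complete curve meets every hypersurface" as it is used in de Jong 1996,
Lemma 4.13 (ii) ("for any irreducible component `C` of `X_ȳ` … `# C ∩ H ≥ 3`"; p. 69): if a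
closed irreducible subset `C` of a scheme `P` proper over a field `K` lies inside an affine open
`U ⊆ P`, then `C` (with its reduced structure) is a closed subscheme of the affine `U`, hence
affine, and proper over `K`, hence finite over `K`, hence discrete — so `C` is a single point.
Consequently a closed irreducible subset of positive dimension of a proper `K`-scheme is not
contained in any affine open; applied to the affine open `X ∩ D₊(G)` this is "`C` meets `V₊(G)`".

* `isAffine_pullback_of_isSeparated` — `U ×_Y V` is affine for `U`, `V` affine over a scheme `Y`
  separated over an affine base (a morphism from an affine scheme to `Y` is then affine, Mathlib
  `IsAffineHom.of_comp`); `isAffineOpen_preimage_pullback_fst` — so the preimage in `X ×_Y V` of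
  an affine open of `X` is affine (used for the geometric fibres `X_ȳ = X ×_Y Spec K` of 4.13);
* `subsingleton_of_isIrreducible_of_subset_affineOpen` — the statement of the title;
* `not_subset_affineOpen_of_one_le_topologicalKrullDim` — its contrapositive for subsets of Krull
  dimension `≥ 1`.

## References

* A. J. de Jong, *Smoothness, semi-stability and alterations*, Publ. Math. IHÉS 83 (1996) 51–93,
  Lemma 4.13 and its proof, pp. 69–70. [DeJong1996]
* R. Hartshorne, *Algebraic Geometry* (1977), II Ex. 4.5 (d)/III Ex. 5.7-type argument: proper and
  affine over a field is finite. [Hartshorne1977]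
-/

noncomputable section

universe u

open CategoryTheory CategoryTheory.Limits AlgebraicGeometry TopologicalSpace Topology

namespace Literature.AlgebraicGeometry.Morphisms

/-! ### Fibre products of affine schemes over a separated scheme -/

/-- **`U ×_Y V` is affine when `U`, `V` are affine and `Y` is separated over an affine base `S`**:
the morphism `U → Y` is affine (its composite with the separated `Y → S` is a morphism of affine
schemes, Mathlib `IsAffineHom.of_comp`), hence so is its base change `U ×_Y V → V`. [folklore] -/
theorem isAffine_pullback_of_isSeparated {U V Y S : Scheme.{u}} [IsAffine U] [IsAffine V]
    [IsAffine S] (u : U ⟶ Y) (v : V ⟶ Y) (g : Y ⟶ S) [IsSeparated g] :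
    IsAffine (pullback u v) := by
  haveI : IsAffineHom (u ≫ g) := isAffineHom_of_isAffine _
  haveI : IsAffineHom u := IsAffineHom.of_comp u g
  haveI : IsAffineHom (pullback.snd u v) := MorphismProperty.pullback_snd _ _ inferInstance
  exact isAffine_of_isAffineHom (pullback.snd u v)

/-- **The preimage in `X ×_Y V` of an affine open `W ⊆ X` is affine** (`V` affine, `Y` separated
over an affine base): it is `W ×_Y V`. Used for the geometric fibres `X ×_Y Spec K` of a morphism
of projective varieties. [folklore] -/
theorem isAffineOpen_preimage_pullback_fst {X V Y S : Scheme.{u}} [IsAffine V] [IsAffine S]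
    (f : X ⟶ Y) (v : V ⟶ Y) (g : Y ⟶ S) [IsSeparated g] {W : X.Opens} (hW : IsAffineOpen W) :
    IsAffineOpen ((pullback.fst f v) ⁻¹ᵁ W) := by
  haveI : IsAffine W := hW
  haveI : IsAffine (pullback (W.ι ≫ f) v) := isAffine_pullback_of_isSeparated (W.ι ≫ f) v g
  -- `pullback.fst ⁻¹ W ≅ W ×_X (X ×_Y V) ≅ W ×_Y V`
  let e : ((pullback.fst f v) ⁻¹ᵁ W : Scheme.{u}) ≅ pullback (W.ι ≫ f) v :=
    (pullbackRestrictIsoRestrict (pullback.fst f v) W).symm ≪≫ pullbackSymmetry _ _ ≪≫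
      pullbackRightPullbackFstIso f v W.ι
  exact IsAffine.of_isIso e.hom

/-! ### Complete irreducible subsets of an affine open -/

/-- **A closed irreducible subset of a proper `K`-scheme contained in an affine open is a single
point.** With its reduced closed subscheme structure `Z`, the inclusion `Z → P` factors through
the affine open `U` by a closed immersion (open immersions are separated), so `Z` is affine; and
`Z → Spec K` is proper; proper and affine is finite (Mathlib
`IsFinite.iff_isProper_and_isAffineHom`), finite is quasi-finite with discrete fibres, and a
discrete irreducible space has one point. [cite: DeJong1996, Lemma 4.13 (ii) (proof), pp. 69–70] -/
theorem subsingleton_of_isIrreducible_of_subset_affineOpen {K : Type u} [Field K] {P : Scheme.{u}}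
    (p : P ⟶ Spec (.of K)) [IsProper p] {C : Set P} (hC : IsIrreducible C) (hCcl : IsClosed C)
    {U : P.Opens} (hU : IsAffineOpen U) (hCU : C ⊆ U) : C.Subsingleton := by
  -- the reduced closed subscheme `Z` on `C`
  set I : P.IdealSheafData := Scheme.IdealSheafData.vanishingIdeal ⟨C, hCcl⟩ with hI
  have hrange : Set.range I.subschemeι = C := by
    rw [Scheme.IdealSheafData.range_subschemeι, hI, Scheme.IdealSheafData.coe_support_vanishingIdeal]
    rfl
  -- `Z → P` factors through `U` by a closed immersion, so `Z` is affine
  have hle : Set.range I.subschemeι ⊆ Set.range U.ι := by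
    rw [hrange, Scheme.Opens.range_ι]
    exact hCU
  let j : I.subscheme ⟶ U := IsOpenImmersion.lift U.ι I.subschemeι hle
  have hj : j ≫ U.ι = I.subschemeι := IsOpenImmersion.lift_fac U.ι I.subschemeι hle
  haveI : IsClosedImmersion (j ≫ U.ι) := by rw [hj]; infer_instance
  haveI : IsClosedImmersion j := IsClosedImmersion.of_comp j U.ι
  haveI : IsAffine U := hU
  haveI : IsAffine I.subscheme := isAffine_of_isAffineHom j
  -- `Z → Spec K` is proper and affine, hence finite
  haveI : IsAffineHom (I.subschemeι ≫ p) := isAffineHom_of_isAffine _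
  haveI : IsFinite (I.subschemeι ≫ p) :=
    IsFinite.iff_isProper_and_isAffineHom.mpr ⟨inferInstance, inferInstance⟩
  -- hence `Z` is discrete
  have hdisc : _root_.IsDiscrete (Set.univ : Set I.subscheme) := by
    have h := (I.subschemeι ≫ p).isDiscrete_preimage_singleton default
    rwa [show (I.subschemeι ≫ p) ⁻¹' {default} = Set.univ from
      Set.eq_univ_of_forall fun z => Subsingleton.elim _ _] at h
  haveI : DiscreteTopology I.subscheme := isDiscrete_univ_iff.mp hdisc
  -- and irreducible (homeomorphic to `C`)
  haveI : IrreducibleSpace C := Subtype.irreducibleSpace hC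
  let e : I.subscheme ≃ₜ C :=
    I.subschemeι.isClosedEmbedding.isEmbedding.toHomeomorph.trans (Homeomorph.setCongr hrange)
  haveI : IrreducibleSpace I.subscheme := e.irreducibleSpace_iff.mpr inferInstance
  -- a discrete irreducible space has one point
  have hZ : ∀ z₁ z₂ : I.subscheme, z₁ = z₂ := by
    intro z₁ z₂
    obtain ⟨z, hz⟩ := (IrreducibleSpace.isIrreducible_univ (I.subscheme : Type u)).2 {z₁} {z₂}
      (isOpen_discrete _) (isOpen_discrete _) ⟨z₁, trivial, rfl⟩ ⟨z₂, trivial, rfl⟩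
    exact hz.2.1.symm.trans hz.2.2
  intro c₁ h₁ c₂ h₂
  have h12 := hZ (e.symm ⟨c₁, h₁⟩) (e.symm ⟨c₂, h₂⟩)
  have h12' : (⟨c₁, h₁⟩ : C) = ⟨c₂, h₂⟩ := e.symm.injective h12
  exact congrArg Subtype.val h12' 

/-- A subsingleton subset has Krull dimension `≤ 0`. [folklore] -/
theorem topologicalKrullDim_le_zero_of_subsingleton {Z : Type*} [TopologicalSpace Z] {C : Set Z}
    (hC : C.Subsingleton) : topologicalKrullDim C ≤ 0 := by
  haveI : Subsingleton C := hC.coe_sort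
  exact topologicalKrullDim_zero_of_discreteTopology C

/-- **A closed irreducible subset of Krull dimension `≥ 1` of a proper `K`-scheme is contained in
no affine open** — "a complete curve is not affine"; with `U = X ∩ D₊(G)` for a hypersurface
`V₊(G)` of the ambient projective space: every such subset meets `V₊(G)`.
[cite: DeJong1996, Lemma 4.13 (ii) (proof), pp. 69–70] -/
theorem not_subset_affineOpen_of_one_le_topologicalKrullDim {K : Type u} [Field K]
    {P : Scheme.{u}} (p : P ⟶ Spec (.of K)) [IsProper p] {C : Set P} (hC : IsIrreducible C)
    (hCcl : IsClosed C) (hdim : 1 ≤ topologicalKrullDim C) {U : P.Opens} (hU : IsAffineOpen U) :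
    ¬ C ⊆ U := fun hCU => by
  have h0 : topologicalKrullDim C ≤ 0 := topologicalKrullDim_le_zero_of_subsingleton
    (subsingleton_of_isIrreducible_of_subset_affineOpen p hC hCcl hU hCU)
  have h10 : (1 : WithBot ℕ∞) ≤ 0 := hdim.trans h0
  exact absurd h10 (by decide)

/-- The same in the form used for hypersurface sections: if `C` is a closed irreducible subset of
Krull dimension `≥ 1` of the proper `K`-scheme `P` and `U ⊆ P` is an affine open, then `C` meets
the complement of `U`. [cite: DeJong1996, Lemma 4.13 (ii) (proof), pp. 69–70] -/
theorem inter_compl_nonempty_of_one_le_topologicalKrullDim {K : Type u} [Field K]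
    {P : Scheme.{u}} (p : P ⟶ Spec (.of K)) [IsProper p] {C : Set P} (hC : IsIrreducible C)
    (hCcl : IsClosed C) (hdim : 1 ≤ topologicalKrullDim C) {U : P.Opens} (hU : IsAffineOpen U) :
    (C ∩ (U : Set P)ᶜ).Nonempty := by
  by_contra h
  rw [Set.not_nonempty_iff_eq_empty, ← Set.sdiff_eq, Set.sdiff_eq_empty] at h
  exact not_subset_affineOpen_of_one_le_topologicalKrullDim p hC hCcl hdim hU h

end Literature.AlgebraicGeometry.Morphisms

end
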